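import Mathlib.Data.Fintype.Sigma
import Mathlib.Logic.Equiv.Fin.Basic
import Mathlib.Order.WellFounded
import Literature.ModelTheory.FiniteModelTheory.WeisfeilerLeman
import HarnessLib

/-!
# `k`-WL equivalence is `C^{k+1}`-equivalence: proof of `immermanLander_wlEquiv_iff_ckEquiv`

Topic `Literature/ModelTheory/FiniteModelTheory`; sibling proof file of `WeisfeilerLeman.lean`,
which DEFINES the `k`-dimensional Weisfeiler–Leman colours `wlColour`, `k`-WL equivalence
`WLEquiv k G H` (agreement of the colour multisets at every round) and states the NAMED FACT
`immermanLander_wlEquiv_iff_ckEquiv` (Dell–Grohe–Rattan 2018, Lemma 12 [Immerman–Lander 1990];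
Cai–Fürer–Immerman 1992, Thm 5.2): for `k ≥ 1` and finite graphs `G` on `Fin n`, `H` on `Fin m`,
`WLEquiv k G H ↔ CkEquiv (k + 1) G H`, where `CkEquiv` (file `CkEquiv.lean`) is Duplicator's
winning strategy in Hella's bijective `(k+1)`-pebble game, presented as a back-and-forth system
`BijPebbleStrategy`. This file PROVES it (`immermanLander_wlEquiv_iff_ckEquiv_holds`).

The printed sources treat Lemma 12 as a black box ("it is safe to treat the logic and the
following lemma as a black-box here", DGR 2018, §8, p. 14) and prove the game/WL correspondence
round by round (Cai–Fürer–Immerman 1992, Thm 5.2: equal round-`r` colours of `k`-configurations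
iff Duplicator survives `r` more moves of the `C^{k+1}` game). We follow that round-by-round
architecture, adapted to the bijective game (Hella 1996), whose one round "Duplicator names a
bijection `f`, Spoiler pebbles `(x, f x)`" is matched by one refinement round
`C_{i+1}(v̄) = (C_i(v̄), {{ (atp(v̄x), (C_i(v̄[j ↦ x]))_j) | x }})`: equality of the two
multisets over `x ∈ V(G)` and `y ∈ V(H)` is exactly the existence of a bijection `f` matching
the entries (`exists_equiv_of_map_univ_eq`).

* Game ⇒ WL (`wlEquiv_of_bijPebbleStrategy`). If the position `{(vⱼ, wⱼ)}` is in the strategy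
  then `C_i(v̄) = C_i(w̄)` for all `i` (`wlColour_eq_of_mem_strategy`, induction on `i`: round `0`
  is DGR's "crucial property" `atp_eq_atp_iff`; at round `i + 1` Duplicator's bijection `f` for
  the position reindexes the multiset, the extended position `{(vⱼ, wⱼ)} ∪ {(x, f x)}` gives the
  atomic type of the extended tuple and, by closure under lifting pebbles, the colours of the
  substituted tuples). Playing the strategy `k` times from `∅` gives a bijection `V^k ≃ W^k`
  whose graph consists of strategy positions (`exists_equiv_tuples_of_strategy`), whence the
  colour multisets agree.
* WL ⇒ game (`ckEquiv_succ_of_wlEquiv`). STABLE ROUND: the sets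
  `E_i = {(v̄, w̄) ∈ V^k × W^k | C_i(v̄) = C_i(w̄)}` decrease with `i` (`wlColour_eq_of_le`), so one
  of minimal size, `E_{i₀}`, satisfies `C_{i₀}(v̄) = C_{i₀}(w̄) → ∀ i, C_i(v̄) = C_i(w̄)`
  (`exists_stable_round`; CFI's / DGR's stable colouring, here for cross pairs). EXTENSION: if
  `v̄ ≈ w̄` (all rounds agree) then round `i₀ + 1` yields a bijection `f` with
  `atp(v̄x) = atp(w̄ f(x))` and `v̄[j ↦ x] ≈ w̄[j ↦ f x]` for all `x`, `j` (`exists_equiv_extend`).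
  START: `WLEquiv` at round `i₀` gives a colour-preserving bijection `V^k ≃ W^k`; it maps constant
  tuples to constant tuples (atomic types), whence a bijection `f₀ : V ≃ W` with
  `(x,…,x) ≈ (f₀ x,…,f₀ x)` (`exists_equiv_const`). STRATEGY: `∅` together with all subsets of
  `{(v₀,w₀),…,(v_{k-1},w_{k-1}),(x,y)}` for `v̄ ≈ w̄`, `atp(v̄x) = atp(w̄y)` and `v̄[j ↦ x] ≈ w̄[j ↦ y]`
  for all `j`; closure under sub-positions is built in, partial isomorphism is `atp_eq_atp_iff`,
  and the forth property is EXTENSION applied to a `≈`-pair of `k`-tuples covering the current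
  position (`≤ k` pebbles), which exists by a pigeonhole over the `k + 1` listed pairs
  (`subset_range_pair_or_update`).

## References

* [DellGroheRattan2018] H. Dell, M. Grohe, G. Rattan, *Lovász meets Weisfeiler and Leman*,
  ICALP 2018 / arXiv:1802.08876, §8 (atomic types, `k`-WL, stable colouring), Lemma 12
  [Immerman–Lander 1990]: "For all k ≥ 1 and all graphs G and H the following are equivalent:
  k-WL distinguishes G and H; the logic C^{k+1} distinguishes G and H." Read: arXiv p. 14.
* [CaiFurerImmerman1992] J.-Y. Cai, M. Fürer, N. Immerman, *An optimal lower bound on the number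
  of variables for graph identification*, Combinatorica 12 (1992), §5, Thm 5.2 (the round-by-round
  correspondence between `k`-dim W-L and the `C^{k+1}` pebble game).
* [Hella1996] L. Hella, *Logical hierarchies in PTIME*, Inform. and Comput. 129 (1996) (the
  bijective pebble game); [GroheOtto2015] M. Grohe, M. Otto, *Pebble games and linear
  equations*, J. Symb. Log. 80 (2015), Thm 2.2.
-/

namespace Literature.ModelTheory.FiniteModelTheory

universe u v

variable {V : Type u} {W : Type v}

/-! ### Two combinatorial tools -/

/-- Two finite families with the same multiset of values differ by a bijection of the index
types: if `{{g₁ a | a}} = {{g₂ b | b}}` then there is `e : α ≃ β` with `g₂ (e a) = g₁ a`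
(glue bijections between the equinumerous fibres). [folklore] -/
theorem exists_equiv_of_map_univ_eq {α β γ : Type*} [Fintype α] [Fintype β] (g₁ : α → γ)
    (g₂ : β → γ)
    (h : (Finset.univ : Finset α).val.map g₁ = (Finset.univ : Finset β).val.map g₂) :
    ∃ e : α ≃ β, ∀ a, g₂ (e a) = g₁ a := by
  classical
  have hfib : ∀ c : γ, Fintype.card {a // g₁ a = c} = Fintype.card {b // g₂ b = c} := by
    intro c
    have hc := congrArg (Multiset.countP (· = c)) h
    simp only [Multiset.countP_map] at hc
    rw [Fintype.card_subtype, Fintype.card_subtype]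
    exact hc
  let F : ∀ c : γ, {a // g₁ a = c} ≃ {b // g₂ b = c} := fun c => Fintype.equivOfCardEq (hfib c)
  refine ⟨(Equiv.sigmaFiberEquiv g₁).symm.trans
    ((Equiv.sigmaCongrRight F).trans (Equiv.sigmaFiberEquiv g₂)), fun a => ?_⟩
  exact (F (g₁ a) ⟨a, rfl⟩).2

/-- The range of a family indexed by `Fin n` has at most `n` elements. [folklore] -/
theorem ncard_range_fin_le {α : Type*} {n : ℕ} (g : Fin n → α) : (Set.range g).ncard ≤ n := by
  rw [← Set.image_univ]
  refine (Set.ncard_image_le Set.finite_univ).trans ?_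
  rw [Set.ncard_univ, Nat.card_eq_fintype_card, Fintype.card_fin]

/-! ### Positions listed by tuples -/

section Positions

variable {k : ℕ}

/-- The position listed by the extended tuples `(v̄, x)`, `(w̄, y)` is the old one plus the new
pair `(x, y)`. [folklore] -/
theorem range_pair_snoc (v : Fin k → V) (w : Fin k → W) (x : V) (y : W) :
    Set.range (fun l : Fin (k + 1) =>
        ((Fin.snoc v x : Fin (k + 1) → V) l, (Fin.snoc w y : Fin (k + 1) → W) l)) =
      insert (x, y) (Set.range fun j : Fin k => (v j, w j)) := by
  have : (fun l : Fin (k + 1) =>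
      ((Fin.snoc v x : Fin (k + 1) → V) l, (Fin.snoc w y : Fin (k + 1) → W) l)) =
      Fin.snoc (fun j => (v j, w j)) (x, y) := by
    funext l
    refine Fin.lastCases ?_ (fun j => ?_) l
    · simp
    · simp [Fin.snoc_castSucc]
  rw [this, Fin.range_snoc]

/-- The position listed by the substituted tuples `v̄[j ↦ x]`, `w̄[j ↦ y]` lies inside the old one
plus `(x, y)` (lift the `j`-th pebble pair, pebble `(x, y)`). [folklore] -/
theorem range_pair_update_subset (v : Fin k → V) (w : Fin k → W) (j : Fin k) (x : V) (y : W) :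
    Set.range (fun l => (Function.update v j x l, Function.update w j y l)) ⊆
      insert (x, y) (Set.range fun l => (v l, w l)) := by
  rintro _ ⟨l, rfl⟩
  by_cases hl : l = j
  · subst hl
    simp
  · simp only [Function.update_of_ne hl]
    exact Or.inr ⟨l, rfl⟩

/-- Pigeonhole behind the forth property: a position with at most `k` pairs inside
`{(v₀,w₀),…,(v_{k-1},w_{k-1}),(x,y)}` lies inside the position of `(v̄, w̄)` or of some
substituted pair `(v̄[j ↦ x], w̄[j ↦ y])`. [folklore] -/
theorem subset_range_pair_or_update {v : Fin k → V} {w : Fin k → W} {x : V} {y : W}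
    {p : Set (V × W)} (hfin : p.Finite)
    (hp : p ⊆ insert (x, y) (Set.range fun j => (v j, w j))) (hcard : p.ncard ≤ k) :
    p ⊆ Set.range (fun j => (v j, w j)) ∨
      ∃ j₁ : Fin k, p ⊆ Set.range fun l => (Function.update v j₁ x l, Function.update w j₁ y l) := by
  by_cases hxy : (x, y) ∈ p
  · right
    by_contra hcon
    push Not at hcon
    -- every listed pair `(vⱼ, wⱼ)` is in `p ∖ {(x, y)}` and is listed only once
    have key : ∀ j₁ : Fin k, (v j₁, w j₁) ∈ p \ {(x, y)} ∧
        ∀ l, (v l, w l) = (v j₁, w j₁) → l = j₁ := by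
      intro j₁
      obtain ⟨q, hq, hq'⟩ := Set.not_subset.1 (hcon j₁)
      have huniq : ∀ l, (v l, w l) = q → l = j₁ := by
        intro l hl
        by_contra hne
        exact hq' ⟨l, by simp [Function.update_of_ne hne, hl]⟩
      rcases hp hq with hqxy | ⟨l, hl⟩
      · exact (hq' ⟨j₁, by simp [hqxy]⟩).elim
      · have hl : (v l, w l) = q := hl
        obtain rfl := huniq l hl
        subst hl
        refine ⟨⟨hq, ?_⟩, fun l' hl' => huniq l' hl'⟩
        rintro (h : (v l, w l) = (x, y))
        exact hq' ⟨l, by simp [h]⟩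
    have hinj : Function.Injective fun j => (v j, w j) := fun l l' h => by
      have h1 := (key l').2 l h
      exact h1
    have hsub : Set.range (fun j => (v j, w j)) ⊆ p \ {(x, y)} := by
      rintro _ ⟨j, rfl⟩
      exact (key j).1
    have h1 : (Set.range fun j => (v j, w j)).ncard = k := by
      rw [Set.ncard_range_of_injective hinj, Nat.card_eq_fintype_card, Fintype.card_fin]
    have h2 := Set.ncard_le_ncard hsub (hfin.subset Set.sdiff_subset)
    have h3 := Set.ncard_sdiff_singleton_add_one hxy hfin
    omega
  · left
    intro q hq
    rcases hp hq with rfl | h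
    · exact (hxy hq).elim
    · exact h

end Positions

/-! ### Rounds of the refinement -/

section Rounds

variable {k : ℕ} {G : SimpleGraph V} {H : SimpleGraph W} [Fintype V] [DecidableEq V]
  [DecidableRel G.Adj] [Fintype W] [DecidableEq W] [DecidableRel H.Adj]

/-- The refinement round, unfolded: `C_{i+1}(v̄) = (C_i(v̄), {{ (atp(v̄x), (C_i(v̄[j ↦ x]))_j) | x }})`.
[cite: DellGroheRattan2018, §8 (display defining C_{i+1}^k)] -/
theorem wlColour_succ (i : ℕ) (v : Fin k → V) :
    wlColour G (i + 1) v = (wlColour G i v, (Finset.univ : Finset V).val.map fun x =>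
      (atp G (Fin.snoc v x : Fin (k + 1) → V), fun j => wlColour G i (Function.update v j x))) :=
  rfl

/-- Later rounds refine earlier ones, across the two graphs: `C_j(v̄) = C_j(w̄)` implies
`C_i(v̄) = C_i(w̄)` for `i ≤ j` (the old colour is the first component of the new one).
[folklore] -/
theorem wlColour_eq_of_le {v : Fin k → V} {w : Fin k → W} {i : ℕ} :
    ∀ {j : ℕ}, i ≤ j → wlColour G j v = wlColour H j w → wlColour G i v = wlColour H i w := by
  intro j hij
  induction hij with
  | refl => exact id
  | step _ ih => exact fun h => ih (congrArg Prod.fst h)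

/-- A STABLE ROUND for cross pairs: there is `i₀` such that `C_{i₀}(G; v̄) = C_{i₀}(H; w̄)` already
forces agreement at every round (the sets of agreeing cross pairs decrease with the round; take
one of minimal size). [cite: DellGroheRattan2018, §8 (stable colouring C_∞)] -/
theorem exists_stable_round (k : ℕ) (G : SimpleGraph V) (H : SimpleGraph W) [DecidableRel G.Adj]
    [DecidableRel H.Adj] :
    ∃ i₀ : ℕ, ∀ (v : Fin k → V) (w : Fin k → W), wlColour G i₀ v = wlColour H i₀ w →
      ∀ i, wlColour G i v = wlColour H i w := by
  classical
  obtain ⟨E, hE⟩ : ∃ E : ℕ → Finset ((Fin k → V) × (Fin k → W)),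
      ∀ i q, q ∈ E i ↔ wlColour G i q.1 = wlColour H i q.2 :=
    ⟨fun i => Finset.univ.filter fun q => wlColour G i q.1 = wlColour H i q.2, fun i q => by simp⟩
  have hanti : ∀ {i j : ℕ}, i ≤ j → E j ⊆ E i := fun hij q hq =>
    (hE _ _).2 (wlColour_eq_of_le hij ((hE _ _).1 hq))
  refine ⟨Function.argmin fun i => (E i).card, fun v w h i => ?_⟩
  have hmem : (v, w) ∈ E (Function.argmin fun i => (E i).card) := (hE _ _).2 h
  rcases le_total i (Function.argmin fun i => (E i).card) with hi | hi
  · exact (hE _ _).1 (hanti hi hmem)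
  · have heq : E i = E (Function.argmin fun i => (E i).card) :=
      Finset.eq_of_subset_of_card_le (hanti hi) (Function.argmin_le (fun i => (E i).card) i)
    rw [← heq] at hmem
    exact (hE _ _).1 hmem

/-- EXTENSION (one round of the game read off one refinement round): if `v̄ ≈ w̄` (all rounds
agree) then there is a bijection `f : V ≃ W` with `atp(v̄x) = atp(w̄ f(x))` and
`v̄[j ↦ x] ≈ w̄[j ↦ f x]` for all `x` and `j` — the multisets `M_{i₀}(v̄) = M_{i₀}(w̄)` of round
`i₀ + 1` are matched by a bijection, and round `i₀` is stable.
[cite: CaiFurerImmerman1992, Thm 5.2 (proof, induction step)] -/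
theorem exists_equiv_extend {i₀ : ℕ}
    (hst : ∀ (v : Fin k → V) (w : Fin k → W), wlColour G i₀ v = wlColour H i₀ w →
      ∀ i, wlColour G i v = wlColour H i w)
    {v : Fin k → V} {w : Fin k → W} (h : ∀ i, wlColour G i v = wlColour H i w) :
    ∃ f : V ≃ W, ∀ x : V,
      atp G (Fin.snoc v x : Fin (k + 1) → V) = atp H (Fin.snoc w (f x) : Fin (k + 1) → W) ∧
      ∀ (j : Fin k) (i : ℕ),
        wlColour G i (Function.update v j x) = wlColour H i (Function.update w j (f x)) := by
  have h1 : ((Finset.univ : Finset V).val.map fun x =>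
      (atp G (Fin.snoc v x : Fin (k + 1) → V), fun j => wlColour G i₀ (Function.update v j x))) =
      (Finset.univ : Finset W).val.map fun y =>
      (atp H (Fin.snoc w y : Fin (k + 1) → W), fun j => wlColour H i₀ (Function.update w j y)) :=
    congrArg Prod.snd (h (i₀ + 1))
  obtain ⟨f, hf⟩ := exists_equiv_of_map_univ_eq _ _ h1
  refine ⟨f, fun x => ?_⟩
  obtain ⟨hx₁, hx₂⟩ := Prod.mk.inj (hf x)
  refine ⟨hx₁.symm, fun j => hst _ _ ?_⟩
  exact (congrFun hx₂ j).symm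

/-- START (the empty position): from `WLEquiv` a bijection `f₀ : V ≃ W` with
`(x,…,x) ≈ (f₀ x,…,f₀ x)` — a colour-preserving bijection `V^k ≃ W^k` at the stable round maps
constant tuples to constant tuples, since colours carry atomic types. Needs `k ≥ 1`.
[cite: CaiFurerImmerman1992, Thm 5.2 (proof, base case)] -/
theorem exists_equiv_const (hk : 1 ≤ k) {i₀ : ℕ}
    (hst : ∀ (v : Fin k → V) (w : Fin k → W), wlColour G i₀ v = wlColour H i₀ w →
      ∀ i, wlColour G i v = wlColour H i w)
    (hWL : WLEquiv k G H) :
    ∃ f : V ≃ W, ∀ (x : V) (i : ℕ),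
      wlColour G i (fun _ : Fin k => x) = wlColour H i (fun _ : Fin k => f x) := by
  have hi₀ : (Finset.univ : Finset (Fin k → V)).val.map (wlColour G i₀) =
      (Finset.univ : Finset (Fin k → W)).val.map (wlColour H i₀) := hWL i₀
  obtain ⟨Φ, hΦ⟩ := exists_equiv_of_map_univ_eq _ _ hi₀
  have hgood : ∀ (u : Fin k → V) (i : ℕ), wlColour G i u = wlColour H i (Φ u) :=
    fun u => hst _ _ (hΦ u).symm
  obtain ⟨z⟩ : Nonempty (Fin k) := ⟨⟨0, hk⟩⟩
  obtain ⟨f, hf⟩ : ∃ f : V → W, ∀ x, f x = Φ (fun _ => x) z := ⟨_, fun _ => rfl⟩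
  have hdiag : ∀ x : V, Φ (fun _ => x) = fun _ => f x := by
    intro x
    have h0 : atp G (fun _ : Fin k => x) = atp H (Φ fun _ => x) := hgood (fun _ => x) 0
    funext j
    rw [hf]
    have hj := congrFun (congrFun h0 j) z
    simp only [atp] at hj
    by_contra hne
    rw [if_neg hne] at hj
    split_ifs at hj <;> exact absurd hj (by decide)
  have hinj : Function.Injective f := by
    intro x x' hxx'
    have h1 : Φ (fun _ => x) = Φ (fun _ => x') := by rw [hdiag, hdiag, hxx']
    exact congrFun (Φ.injective h1) z
  have hbij : Function.Bijective f :=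
    (Fintype.bijective_iff_injective_and_card f).2 ⟨hinj, hWL.card_eq (by omega)⟩
  refine ⟨Equiv.ofBijective f hbij, fun x i => ?_⟩
  have h1 := hgood (fun _ => x) i
  rwa [hdiag] at h1

end Rounds

/-! ### Game ⇒ WL -/

section GameToWL

variable {k : ℕ} {G : SimpleGraph V} {H : SimpleGraph W} [Fintype V] [DecidableEq V]
  [DecidableRel G.Adj] [Fintype W] [DecidableEq W] [DecidableRel H.Adj]

/-- Positions of a winning strategy in the bijective `(k+1)`-pebble game have equal `k`-WL colours
at every round: if `{(vⱼ, wⱼ) | j < k} ∈ S` then `C_i(G; v̄) = C_i(H; w̄)` (induction on the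
round; Duplicator's bijection for the position reindexes the refinement multiset).
[cite: CaiFurerImmerman1992, Thm 5.2 (game ⇒ equal colours)] -/
theorem wlColour_eq_of_mem_strategy (S : BijPebbleStrategy (k + 1) G H) :
    ∀ (i : ℕ) (v : Fin k → V) (w : Fin k → W),
      Set.range (fun j => (v j, w j)) ∈ S.carrier → wlColour G i v = wlColour H i w
  | 0, v, w, hvw => (atp_eq_atp_iff v w).2 (S.isPartialIso_of_mem hvw)
  | i + 1, v, w, hvw => by
    obtain ⟨f, hf⟩ := S.forth hvw (Nat.lt_succ_of_le (ncard_range_fin_le _))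
    rw [wlColour_succ, wlColour_succ]
    refine Prod.ext (wlColour_eq_of_mem_strategy S i v w hvw) ?_
    dsimp only
    have huniv : (Finset.univ : Finset W).val = (Finset.univ : Finset V).val.map f := by
      rw [← Finset.map_univ_equiv f, Finset.map_val]
      rfl
    rw [huniv, Multiset.map_map]
    refine Multiset.map_congr rfl fun x _ => ?_
    simp only [Function.comp_apply]
    have hmem : insert (x, f x) (Set.range fun j => (v j, w j)) ∈ S.carrier := hf x
    refine Prod.ext ?_ (funext fun j => ?_)
    · refine (atp_eq_atp_iff _ _).2 ?_
      rw [range_pair_snoc]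
      exact S.isPartialIso_of_mem hmem
    · exact wlColour_eq_of_mem_strategy S i _ _
        (S.mem_of_subset hmem (range_pair_update_subset v w j x (f x)))

omit [Fintype V] [DecidableEq V] [DecidableRel G.Adj] [Fintype W] [DecidableEq W]
  [DecidableRel H.Adj] in
/-- Playing a winning strategy `l` more times from a position `p` (with room for `l` more pebble
pairs) yields a bijection `Φ` between `l`-tuples whose graphs `p ∪ {(uⱼ, Φ(ū)ⱼ)}` are all
positions of the strategy (Duplicator's bijections composed along the tuple). [folklore] -/
theorem exists_equiv_tuples_of_strategy (S : BijPebbleStrategy (k + 1) G H) :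
    ∀ (l : ℕ) (p : Set (V × W)), p ∈ S.carrier → p.ncard + l ≤ k + 1 →
      ∃ Φ : (Fin l → V) ≃ (Fin l → W), ∀ u : Fin l → V,
        p ∪ Set.range (fun j => (u j, Φ u j)) ∈ S.carrier
  | 0, p, hp, _ => ⟨Equiv.ofUnique _ _, fun u => by
      rwa [Set.range_eq_empty, Set.union_empty]⟩
  | l + 1, p, hp, hpl => by
    obtain ⟨f, hf⟩ := S.forth hp (by omega)
    have IH : ∀ a : V, ∃ Φ : (Fin l → V) ≃ (Fin l → W), ∀ u : Fin l → V,
        insert (a, f a) p ∪ Set.range (fun j => (u j, Φ u j)) ∈ S.carrier := by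
      intro a
      refine exists_equiv_tuples_of_strategy S l _ (hf a) ?_
      have := Set.ncard_insert_le (a, f a) p
      omega
    choose Φ hΦ using IH
    obtain ⟨Ψ, hΨ⟩ : ∃ Ψ : (Fin (l + 1) → V) ≃ (Fin (l + 1) → W),
        ∀ u, Ψ u = Fin.cons (f (u 0)) (Φ (u 0) (Fin.tail u)) :=
      ⟨(Fin.consEquiv fun _ => V).symm.trans
        (((Equiv.prodCongrRight Φ).trans (Equiv.prodCongrLeft fun _ => f)).trans
          (Fin.consEquiv fun _ => W)), fun u => rfl⟩
    refine ⟨Ψ, fun u => ?_⟩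
    have hrange : Set.range (fun j => (u j, Ψ u j)) =
        insert (u 0, f (u 0)) (Set.range fun j => (Fin.tail u j, Φ (u 0) (Fin.tail u) j)) := by
      rw [hΨ, ← Fin.range_cons]
      congr 1
      funext j
      refine Fin.cases ?_ (fun j => ?_) j
      · simp
      · simp [Fin.tail]
    rw [hrange, Set.union_insert, ← Set.insert_union]
    exact hΦ (u 0) (Fin.tail u)

/-- **Game ⇒ WL.** A winning strategy for Duplicator in the bijective `(k+1)`-pebble game makes
the `k`-WL colour multisets of `G` and `H` agree at every round.
[cite: DellGroheRattan2018, Lemma 12 (C^{k+1}-equivalent ⇒ not distinguished by k-WL)] -/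
theorem wlEquiv_of_bijPebbleStrategy (S : BijPebbleStrategy (k + 1) G H) : WLEquiv k G H := by
  intro i
  obtain ⟨Φ, hΦ⟩ := exists_equiv_tuples_of_strategy S k ∅ S.empty_mem
    (by rw [Set.ncard_empty]; omega)
  have huniv : (Finset.univ : Finset (Fin k → W)).val =
      (Finset.univ : Finset (Fin k → V)).val.map Φ := by
    rw [← Finset.map_univ_equiv Φ, Finset.map_val]
    rfl
  simp only [wlColours]
  rw [huniv, Multiset.map_map]
  refine Multiset.map_congr rfl fun v _ => ?_
  simp only [Function.comp_apply]
  refine wlColour_eq_of_mem_strategy S i v (Φ v) ?_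
  have h := hΦ v
  rwa [Set.empty_union] at h

end GameToWL

/-! ### WL ⇒ game -/

section WLToGame

variable {k : ℕ} {G : SimpleGraph V} {H : SimpleGraph W} [Fintype V] [DecidableEq V]
  [DecidableRel G.Adj] [Fintype W] [DecidableEq W] [DecidableRel H.Adj]

/-- **WL ⇒ game.** For `k ≥ 1`, if the `k`-WL colour multisets agree at every round then
Duplicator wins the bijective `(k+1)`-pebble game: her winning positions are `∅` and the subsets
of `{(v₀,w₀),…,(v_{k-1},w_{k-1}),(x,y)}` for `v̄ ≈ w̄` with `atp(v̄x) = atp(w̄y)` and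
`v̄[j ↦ x] ≈ w̄[j ↦ y]` for all `j` (`≈` = equal colours at all rounds); the forth property is
`exists_equiv_extend` at a `≈`-pair covering the current position (`subset_range_pair_or_update`),
and `exists_equiv_const` at `∅`.
[cite: DellGroheRattan2018, Lemma 12 (not distinguished by k-WL ⇒ C^{k+1}-equivalent)] -/
theorem ckEquiv_succ_of_wlEquiv (hk : 1 ≤ k) (hWL : WLEquiv k G H) : CkEquiv (k + 1) G H := by
  obtain ⟨i₀, hst⟩ := exists_stable_round k G H
  obtain ⟨f₀, hf₀⟩ := exists_equiv_const hk hst hWL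
  refine ⟨{ carrier := {p | p = ∅ ∨ ∃ (v : Fin k → V) (w : Fin k → W) (x : V) (y : W),
              (∀ i, wlColour G i v = wlColour H i w) ∧
              atp G (Fin.snoc v x : Fin (k + 1) → V) = atp H (Fin.snoc w y : Fin (k + 1) → W) ∧
              (∀ (j : Fin k) (i : ℕ), wlColour G i (Function.update v j x) =
                wlColour H i (Function.update w j y)) ∧
              p ⊆ Set.range (fun l : Fin (k + 1) =>
                ((Fin.snoc v x : Fin (k + 1) → V) l, (Fin.snoc w y : Fin (k + 1) → W) l))}
            empty_mem := Or.inl rfl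
            finite_of_mem := fun p _ => Set.toFinite p
            ncard_le_of_mem := ?_
            isPartialIso_of_mem := ?_
            mem_of_subset := ?_
            forth := ?_ }⟩
  · rintro p (rfl | ⟨v, w, x, y, -, -, -, hp⟩)
    · simp
    · exact (Set.ncard_le_ncard hp (Set.toFinite _)).trans (ncard_range_fin_le _)
  · rintro p (rfl | ⟨v, w, x, y, -, hatp, -, hp⟩)
    · exact IsPartialIso.empty G H
    · exact ((atp_eq_atp_iff _ _).1 hatp).mono hp
  · rintro p (rfl | ⟨v, w, x, y, hgood, hatp, hupd, hp⟩) q hq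
    · exact Or.inl (Set.subset_empty_iff.1 hq)
    · exact Or.inr ⟨v, w, x, y, hgood, hatp, hupd, hq.trans hp⟩
  · intro p hpS hpk
    rcases p.eq_empty_or_nonempty with rfl | hne
    · -- the empty position: announce `f₀`; `{(x, f₀ x)}` is listed by constant tuples
      refine ⟨f₀, fun x => Or.inr ⟨fun _ => x, fun _ => f₀ x, x, f₀ x, hf₀ x, ?_, ?_, ?_⟩⟩
      · have h1 : (Fin.snoc (fun _ : Fin k => x) x : Fin (k + 1) → V) = fun _ => x := by
          funext l
          refine Fin.lastCases ?_ (fun j => ?_) l <;> simp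
        have h2 : (Fin.snoc (fun _ : Fin k => f₀ x) (f₀ x) : Fin (k + 1) → W) = fun _ => f₀ x := by
          funext l
          refine Fin.lastCases ?_ (fun j => ?_) l <;> simp
        rw [h1, h2]
        funext a b
        simp [atp]
      · intro j i
        have h1 : Function.update (fun _ : Fin k => x) j x = fun _ => x :=
          Function.update_eq_self j _
        have h2 : Function.update (fun _ : Fin k => f₀ x) j (f₀ x) = fun _ => f₀ x :=
          Function.update_eq_self j _
        rw [h1, h2]
        exact hf₀ x i
      · rintro q (rfl | hq)
        · exact ⟨Fin.last k, by simp⟩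
        · exact hq.elim
    · rcases hpS with rfl | ⟨v, w, x, y, hgood, hatp, hupd, hp⟩
      · exact (Set.not_nonempty_empty hne).elim
      · -- a `≈`-pair of `k`-tuples covering `p` (pigeonhole), then EXTENSION
        obtain ⟨v₁, w₁, hgood₁, hp₁⟩ : ∃ (v₁ : Fin k → V) (w₁ : Fin k → W),
            (∀ i, wlColour G i v₁ = wlColour H i w₁) ∧
              p ⊆ Set.range fun j => (v₁ j, w₁ j) := by
          rw [range_pair_snoc] at hp
          rcases subset_range_pair_or_update (Set.toFinite p) hp (by omega) with h | ⟨j₁, h⟩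
          · exact ⟨v, w, hgood, h⟩
          · exact ⟨_, _, hupd j₁, h⟩
        obtain ⟨f, hf⟩ := exists_equiv_extend hst hgood₁
        refine ⟨f, fun x' => Or.inr ⟨v₁, w₁, x', f x', hgood₁, (hf x').1, (hf x').2, ?_⟩⟩
        rw [range_pair_snoc]
        exact Set.insert_subset_insert hp₁

end WLToGame

/-! ### The named fact, discharged -/

/-- **`k`-WL equivalence is `C^{k+1}`-equivalence** (Dell–Grohe–Rattan 2018, Lemma 12
[Immerman–Lander 1990]; Cai–Fürer–Immerman 1992, Thm 5.2), discharging the named fact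
`immermanLander_wlEquiv_iff_ckEquiv` of `WeisfeilerLeman.lean`: for `k ≥ 1` and finite graphs
`G` on `Fin n`, `H` on `Fin m`, `WLEquiv k G H ↔ CkEquiv (k + 1) G H`.
[cite: DellGroheRattan2018, Lemma 12 (k-WL ≡ C^{k+1}, Immerman–Lander)] -/
theorem immermanLander_wlEquiv_iff_ckEquiv_holds : immermanLander_wlEquiv_iff_ckEquiv := by
  intro k hk n m G H _ _
  exact ⟨fun hWL => ckEquiv_succ_of_wlEquiv hk hWL, fun ⟨S⟩ => wlEquiv_of_bijPebbleStrategy S⟩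

end Literature.ModelTheory.FiniteModelTheory
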